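import Mathlib
import Summits.Ventures.PercRepro2.Defs
import Summits.Ventures.PercRepro2.Graph
import Summits.Ventures.PercRepro2.Harris
import Summits.Ventures.PercRepro2.PartitionThreeComplement
import Summits.Ventures.PercRepro2.HarrisComplement
import Summits.Ventures.PercRepro2.OneColourSwitch
import Summits.Ventures.PercRepro2.CutVertexPaths

/-!
# `m9` at a cut vertex: the exact product formula `Σ_Sep σ_pq · σ_rs = −2·α·β`
(blind cell PercRepro2, p3 g16, 2026-08-27; `proofs/P3-CPNC.md` §13)

For a uniform 2-colouring `ω` (the `Y`-colour; `OneColourSwitch.compl ω` the `W`-colour) of the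
edges of a finite multigraph with marks `p, q, r, s`, the switching move `m9` of row 2′CSW is the
sign form `Σ_ω 1_Sep(ω) · σ_pq(ω) · σ_rs(ω) ≤ 0` (`OneColourSwitch.m9SignSum`), `Sep` = «`{p,q}`
and `{r,s}` separated in both colours», `σ_ab = 1[a ~_Y b] − 1[a ~_W b]`.

**Theorem.** If one vertex `v` separates `{p,q}` from `{r,s}` — every edge lies on the left side
(endpoints in `L ∪ {v}`) or on the right side (endpoints in `Rt ∪ {v}`), `p, q ∈ L ∪ {v}`,
`r, s ∈ Rt ∪ {v}` (`CutVertex`) — then, with `N = 2^{|E|}` the number of configurations,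
`N · Σ_Sep σ_pq σ_rs = −2 · α · β`, `α = Σ_ω 1[{p,q} ~_Y v] · σ_pq(ω)`,
`β = Σ_ω 1[{r,s} ~_Y v] · σ_rs(ω)` (`card_mul_m9SignSum_eq`), and `α, β ≥ 0`
(`aInd_mul_sigma_sum_nonneg`: Harris with the complement, `HarrisComplement`), hence
`m9SignSum ≤ 0` (`m9SignSum_nonpos_of_cutVertex`).

Proof. Every `{p,q}`–`{r,s}` path passes `v` (`conn_cross_iff` of `CutVertexPaths.lean`), so `1_Sep = (1 − a_Y b_Y)(1 − a_W b_W)` with `a_Z = 1[{p,q} ~_Z v]`,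
`b_Z = 1[{r,s} ~_Z v]`; `a_Y, a_W, σ_pq` depend only on the left edges, `b_Y, b_W, σ_rs` only on
the right edges, so every term of the expansion factorises (`sum_mul_mul_card`: an involution of
the pairs of configurations, no probability needed); the colour flip kills `Σ σ_pq` and
`Σ a_Y a_W σ_pq` and identifies the two cross terms.  Own work (one seat); std axioms.
-/

namespace Summit.Ventures.PercRepro2

namespace CutVertexM9

open Finset Classical

variable {V : Type*} {E : Type*}

/-! ## The indicator `a_Y = 1[{a,b} ~_Y c]`, the kernel expansion and the factorisation -/

section SignForm

variable [Fintype E] [DecidableEq E]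
variable (ends : E → Sym2 V)

/-- `1[a ~_Y c ∨ b ~_Y c]`: the pair `{a,b}` reaches `c` in the colour `ω`. -/
noncomputable def aInd (a b c : V) (ω : Config E) : ℤ :=
  if Conn ends ω a c ∨ Conn ends ω b c then 1 else 0

variable {ends}

/-- Propositional shape of the one-colour separation through a cut vertex. -/
lemma sep_logic {A B C D : Prop} :
    (¬ (A ∧ C) ∧ ¬ (A ∧ D) ∧ ¬ (B ∧ C) ∧ ¬ (B ∧ D)) ↔ ¬ ((A ∨ B) ∧ (C ∨ D)) := by
  tauto

omit [Fintype E] [DecidableEq E] in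
/-- The one-colour separation at a cut vertex: `¬(a_Y ∧ b_Y)` with `a_Y = {p,q} ~ v`,
`b_Y = {r,s} ~ v`. -/
theorem sepY_iff {side : E → Bool} {L : Set V} {v : V} {Rt : Set V}
    (h : CutVertex ends side L v Rt) {p q r s : V} (hp : p ∈ L ∨ p = v) (hq : q ∈ L ∨ q = v)
    (hr : r ∈ Rt ∨ r = v) (hs : s ∈ Rt ∨ s = v) (ω : Config E) :
    OneColourSwitch.sepY ends p q r s ω ↔
      ¬ ((Conn ends ω p v ∨ Conn ends ω q v) ∧ (Conn ends ω r v ∨ Conn ends ω s v)) := by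
  unfold OneColourSwitch.sepY
  rw [conn_cross_iff h hp hr ω, conn_cross_iff h hp hs ω, conn_cross_iff h hq hr ω,
    conn_cross_iff h hq hs ω]
  exact sep_logic

omit [Fintype E] [DecidableEq E] in
/-- The two-colour separation at a cut vertex:
`¬(a_Y ∧ b_Y) ∧ ¬(a_W ∧ b_W)` with `a_Z = {p,q} ~_Z v`, `b_Z = {r,s} ~_Z v`. -/
theorem sep2_iff {side : E → Bool} {L : Set V} {v : V} {Rt : Set V}
    (h : CutVertex ends side L v Rt) {p q r s : V} (hp : p ∈ L ∨ p = v) (hq : q ∈ L ∨ q = v)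
    (hr : r ∈ Rt ∨ r = v) (hs : s ∈ Rt ∨ s = v) (ω : Config E) :
    OneColourSwitch.sep2 ends p q r s ω ↔
      (¬ ((Conn ends ω p v ∨ Conn ends ω q v) ∧ (Conn ends ω r v ∨ Conn ends ω s v))) ∧
      (¬ ((Conn ends (OneColourSwitch.compl ω) p v ∨ Conn ends (OneColourSwitch.compl ω) q v) ∧
        (Conn ends (OneColourSwitch.compl ω) r v ∨ Conn ends (OneColourSwitch.compl ω) s v))) := by
  unfold OneColourSwitch.sep2
  rw [sepY_iff h hp hq hr hs ω, sepY_iff h hp hq hr hs (OneColourSwitch.compl ω)]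

omit [Fintype E] [DecidableEq E] in
/-- The pointwise expansion of the `m9` kernel at a cut vertex:
`1_Sep σ_pq σ_rs = (1 − a_Y b_Y)(1 − a_W b_W) σ_pq σ_rs`. -/
theorem kernel_eq {side : E → Bool} {L : Set V} {v : V} {Rt : Set V}
    (h : CutVertex ends side L v Rt) {p q r s : V} (hp : p ∈ L ∨ p = v) (hq : q ∈ L ∨ q = v)
    (hr : r ∈ Rt ∨ r = v) (hs : s ∈ Rt ∨ s = v) (ω : Config E) :
    (if OneColourSwitch.sep2 ends p q r s ω then
        OneColourSwitch.sigma ends ω p q * OneColourSwitch.sigma ends ω r s else 0) =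
      (1 - aInd ends p q v ω * aInd ends r s v ω) *
        (1 - aInd ends p q v (OneColourSwitch.compl ω) * aInd ends r s v (OneColourSwitch.compl ω)) *
        (OneColourSwitch.sigma ends ω p q * OneColourSwitch.sigma ends ω r s) := by
  rw [sep2_iff h hp hq hr hs ω]
  unfold aInd
  by_cases h1 : Conn ends ω p v ∨ Conn ends ω q v <;>
    by_cases h2 : Conn ends ω r v ∨ Conn ends ω s v <;>
    by_cases h3 : Conn ends (OneColourSwitch.compl ω) p v ∨
      Conn ends (OneColourSwitch.compl ω) q v <;>
    by_cases h4 : Conn ends (OneColourSwitch.compl ω) r v ∨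
      Conn ends (OneColourSwitch.compl ω) s v <;>
    simp [h1, h2, h3, h4]

omit [Fintype E] [DecidableEq E] in
/-- The colour flip negates `σ`. -/
lemma sigma_compl (ω : Config E) (a b : V) :
    OneColourSwitch.sigma ends (OneColourSwitch.compl ω) a b = - OneColourSwitch.sigma ends ω a b := by
  simp only [OneColourSwitch.sigma, OneColourSwitch.compl_compl]
  ring

/-- Reindexing a sum over configurations by the colour flip. -/
lemma sum_compl (F : Config E → ℤ) : ∑ ω, F (OneColourSwitch.compl ω) = ∑ ω, F ω :=
  Equiv.sum_comp OneColourSwitch.complPerm F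

/-- `Σ_ω σ_ab(ω) = 0` (the flip is a sign-reversing involution). -/
lemma sum_sigma_eq_zero (a b : V) : ∑ ω : Config E, OneColourSwitch.sigma ends ω a b = 0 := by
  have h := sum_compl (fun ω : Config E => OneColourSwitch.sigma ends ω a b)
  simp only [sigma_compl, Finset.sum_neg_distrib] at h
  linarith

/-- `Σ a_W σ = −Σ a_Y σ`. -/
lemma sum_aInd_compl_mul_sigma (a b c : V) :
    ∑ ω : Config E, aInd ends a b c (OneColourSwitch.compl ω) * OneColourSwitch.sigma ends ω a b =
      - ∑ ω : Config E, aInd ends a b c ω * OneColourSwitch.sigma ends ω a b := by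
  have h := sum_compl (fun ω : Config E =>
    aInd ends a b c (OneColourSwitch.compl ω) * OneColourSwitch.sigma ends ω a b)
  simp only [OneColourSwitch.compl_compl, sigma_compl, mul_neg, Finset.sum_neg_distrib] at h
  linarith

/-- `Σ a_Y a_W σ = 0`. -/
lemma sum_aInd_mul_aInd_compl_mul_sigma (a b c : V) :
    ∑ ω : Config E, aInd ends a b c ω * aInd ends a b c (OneColourSwitch.compl ω) *
      OneColourSwitch.sigma ends ω a b = 0 := by
  have h := sum_compl (fun ω : Config E => aInd ends a b c ω *
    aInd ends a b c (OneColourSwitch.compl ω) * OneColourSwitch.sigma ends ω a b)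
  simp only [OneColourSwitch.compl_compl, sigma_compl, mul_neg, Finset.sum_neg_distrib] at h
  have h2 : ∑ ω : Config E, aInd ends a b c (OneColourSwitch.compl ω) * aInd ends a b c ω *
      OneColourSwitch.sigma ends ω a b =
      ∑ ω : Config E, aInd ends a b c ω * aInd ends a b c (OneColourSwitch.compl ω) *
        OneColourSwitch.sigma ends ω a b :=
    Finset.sum_congr rfl (fun ω _ => by ring)
  linarith

/-- Mix two configurations: the edges of side `true` from `ω`, the others from `ω'`. -/
def mix (side : E → Bool) (ω ω' : Config E) : Config E :=
  fun e => if side e = true then ω e else ω' e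

omit [Fintype E] [DecidableEq E] in
/-- Mixing twice gives back the first configuration. -/
lemma mix_mix (side : E → Bool) (ω ω' : Config E) :
    mix side (mix side ω ω') (mix side ω' ω) = ω := by
  funext e
  simp only [mix]
  rcases Bool.eq_false_or_eq_true (side e) with hs | hs <;> simp [hs]

/-- `(ω, ω') ↦ (mix ω ω', mix ω' ω)`: an involution of the pairs of configurations. -/
def mixPerm (side : E → Bool) : Equiv.Perm (Config E × Config E) :=
  Function.Involutive.toPerm (fun x => (mix side x.1 x.2, mix side x.2 x.1))
    (fun x => Prod.ext (mix_mix side x.1 x.2) (mix_mix side x.2 x.1))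

/-- **Factorisation.** If `f` reads only the edges of side `true` and `g` only those of side
`false`, then `(Σ_ω f g) · #Config = (Σ_ω f) · (Σ_ω g)`. -/
theorem sum_mul_mul_card (side : E → Bool) (f g : Config E → ℤ)
    (hf : ∀ ω ω', (∀ e, side e = true → ω e = ω' e) → f ω = f ω')
    (hg : ∀ ω ω', (∀ e, side e = false → ω e = ω' e) → g ω = g ω') :
    (∑ ω, f ω * g ω) * (Fintype.card (Config E) : ℤ) = (∑ ω, f ω) * (∑ ω, g ω) := by
  have hmix1 : ∀ ω ω', f (mix side ω ω') = f ω :=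
    fun ω ω' => hf _ _ (fun e he => by simp [mix, he])
  have hmix2 : ∀ ω ω', g (mix side ω ω') = g ω' :=
    fun ω ω' => hg _ _ (fun e he => by simp [mix, he])
  calc (∑ ω, f ω * g ω) * (Fintype.card (Config E) : ℤ)
      = ∑ ω, ∑ _ω' : Config E, f ω * g ω := by
        rw [Finset.sum_mul]
        refine Finset.sum_congr rfl fun ω _ => ?_
        rw [Finset.sum_const, Finset.card_univ, nsmul_eq_mul]
        ring
    _ = ∑ x : Config E × Config E, f x.1 * g x.1 := by rw [Fintype.sum_prod_type]
    _ = ∑ x : Config E × Config E, f (mixPerm side x).1 * g (mixPerm side x).1 :=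
        (Equiv.sum_comp (mixPerm side) (fun x : Config E × Config E => f x.1 * g x.1)).symm
    _ = ∑ x : Config E × Config E, f x.1 * g x.2 := by
        refine Finset.sum_congr rfl fun x _ => ?_
        simp only [mixPerm, Function.Involutive.coe_toPerm, hmix1, hmix2]
    _ = (∑ ω, f ω) * (∑ ω, g ω) := by rw [Fintype.sum_prod_type, Finset.sum_mul_sum]

end SignForm

/-! ## Harris with the complement: `α = Σ a_Y σ ≥ 0` -/

section Harris

variable [Fintype E] [DecidableEq E]

/-- **Harris with the complement, counted** (the tree's
`HarrisComplement.prob_inter_complEvent_le_prob_inter` at `p ≡ 1/2`): for increasing `A`, `B`,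
`#{ω ∈ B, ω̄ ∈ A} ≤ #{ω ∈ A ∩ B}`. -/
theorem card_filter_le_of_isUpperSet {A B : Set (Config E)} (hA : IsUpperSet A)
    (hB : IsUpperSet B) (P Q : Config E → Prop) [DecidablePred P] [DecidablePred Q]
    (hP : ∀ ω, P ω ↔ ω ∈ A ∧ ω ∈ B) (hQ : ∀ ω, Q ω ↔ ω ∈ B ∧ OneColourSwitch.compl ω ∈ A) :
    (univ.filter Q).card ≤ (univ.filter P).card := by
  let p : E → ℚ := fun _ => 1 / 2
  have hp : IsProbVec p := ⟨fun _ => by norm_num [p], fun _ => by norm_num [p]⟩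
  have hsym : ∀ e, p e + p e = 1 := fun _ => by norm_num [p]
  have hw : ∀ ω : Config E, weight p ω = (1 / 2 : ℚ) ^ Fintype.card E := by
    intro ω
    rw [weight_apply]
    have hef : ∀ e, edgeFactor (p e) (ω e) = (1 / 2 : ℚ) := fun e => by
      cases ω e <;> norm_num [edgeFactor, p]
    rw [Finset.prod_congr rfl (fun e _ => hef e), Finset.prod_const, Finset.card_univ]
  have hprob : ∀ (S : Set (Config E)) [DecidablePred (· ∈ S)],
      prob p S = (1 / 2 : ℚ) ^ Fintype.card E * ((univ.filter (· ∈ S)).card : ℚ) := by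
    intro S _
    rw [prob_eq_sum_filter, Finset.sum_congr rfl (fun ω _ => hw ω), Finset.sum_const,
      nsmul_eq_mul]
    ring
  have key := prob_inter_complEvent_le_prob_inter hp hsym hA hB
  rw [hprob, hprob] at key
  have hpos : (0 : ℚ) < (1 / 2 : ℚ) ^ Fintype.card E := by positivity
  have key2 := le_of_mul_le_mul_left key hpos
  have hQ' : univ.filter Q = univ.filter (· ∈ B ∩ complEvent A) :=
    Finset.filter_congr (fun ω _ => by rw [hQ]; exact Iff.rfl)
  have hP' : univ.filter P = univ.filter (· ∈ A ∩ B) :=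
    Finset.filter_congr (fun ω _ => by rw [hP]; exact Iff.rfl)
  rw [hQ', hP']
  exact_mod_cast key2

/-- **`α ≥ 0`**: `Σ_ω 1[{a,b} ~_Y c] · σ_ab(ω) ≥ 0` on every multigraph — the event `{a,b} ~ c`
is increasing, `a ~ b` increasing, so `#{{a,b} ~_Y c, a ~_Y b} ≥ #{{a,b} ~_Y c, a ~_W b}`
(Harris with the complement). -/
theorem aInd_mul_sigma_sum_nonneg (ends : E → Sym2 V) (a b c : V) :
    0 ≤ ∑ ω : Config E, aInd ends a b c ω * OneColourSwitch.sigma ends ω a b := by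
  have hA : IsUpperSet (connEvent ends a b) := isUpperSet_connEvent ends a b
  have hB : IsUpperSet (connEvent ends a c ∪ connEvent ends b c) :=
    (isUpperSet_connEvent ends a c).union (isUpperSet_connEvent ends b c)
  have key := card_filter_le_of_isUpperSet hA hB
    (fun ω => Conn ends ω a b ∧ (Conn ends ω a c ∨ Conn ends ω b c))
    (fun ω => (Conn ends ω a c ∨ Conn ends ω b c) ∧ Conn ends (OneColourSwitch.compl ω) a b)
    (fun ω => by simp only [connEvent, Set.mem_union, Set.mem_setOf_eq])
    (fun ω => by simp only [connEvent, Set.mem_union, Set.mem_setOf_eq])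
  have hsum : ∑ ω : Config E, aInd ends a b c ω * OneColourSwitch.sigma ends ω a b =
      ∑ ω : Config E, ((if Conn ends ω a b ∧ (Conn ends ω a c ∨ Conn ends ω b c) then (1 : ℤ)
        else 0) -
        (if (Conn ends ω a c ∨ Conn ends ω b c) ∧ Conn ends (OneColourSwitch.compl ω) a b then
          (1 : ℤ) else 0)) := by
    refine Finset.sum_congr rfl fun ω _ => ?_
    unfold aInd OneColourSwitch.sigma
    by_cases h1 : Conn ends ω a c ∨ Conn ends ω b c <;> by_cases h2 : Conn ends ω a b <;>
      by_cases h3 : Conn ends (OneColourSwitch.compl ω) a b <;> simp [h1, h2, h3]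
  rw [hsum, Finset.sum_sub_distrib, Finset.sum_boole, Finset.sum_boole]
  have key' : ((univ.filter (fun ω : Config E =>
      (Conn ends ω a c ∨ Conn ends ω b c) ∧ Conn ends (OneColourSwitch.compl ω) a b)).card : ℤ) ≤
      ((univ.filter (fun ω : Config E =>
        Conn ends ω a b ∧ (Conn ends ω a c ∨ Conn ends ω b c))).card : ℤ) := by
    exact_mod_cast key
  linarith

end Harris

/-! ## The theorem -/

section Main

variable [Fintype E] [DecidableEq E]
variable {ends : E → Sym2 V} {side : E → Bool} {L : Set V} {v : V} {Rt : Set V}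

omit [Fintype E] [DecidableEq E] in
/-- `σ_pq` reads only the left edges. -/
lemma sigma_congr_left (h : CutVertex ends side L v Rt) {p q : V} (hp : p ∈ L ∨ p = v)
    (hq : q ∈ L ∨ q = v) {ω ω' : Config E} (hag : ∀ e, side e = true → ω e = ω' e) :
    OneColourSwitch.sigma ends ω p q = OneColourSwitch.sigma ends ω' p q := by
  unfold OneColourSwitch.sigma
  rw [conn_left_congr h hp hq hag, conn_left_congr h hp hq (compl_agree hag)]

omit [Fintype E] [DecidableEq E] in
/-- `a_Y = 1[{p,q} ~ v]` reads only the left edges. -/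
lemma aInd_congr_left (h : CutVertex ends side L v Rt) {p q : V} (hp : p ∈ L ∨ p = v)
    (hq : q ∈ L ∨ q = v) {ω ω' : Config E} (hag : ∀ e, side e = true → ω e = ω' e) :
    aInd ends p q v ω = aInd ends p q v ω' := by
  unfold aInd
  rw [conn_left_congr h hp (Or.inr rfl) hag, conn_left_congr h hq (Or.inr rfl) hag]

omit [Fintype E] [DecidableEq E] in
/-- `σ_rs` reads only the right edges. -/
lemma sigma_congr_right (h : CutVertex ends side L v Rt) {r s : V} (hr : r ∈ Rt ∨ r = v)
    (hs : s ∈ Rt ∨ s = v) {ω ω' : Config E} (hag : ∀ e, side e = false → ω e = ω' e) :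
    OneColourSwitch.sigma ends ω r s = OneColourSwitch.sigma ends ω' r s := by
  unfold OneColourSwitch.sigma
  rw [conn_right_congr h hr hs hag, conn_right_congr h hr hs (compl_agree hag)]

omit [Fintype E] [DecidableEq E] in
/-- `b_Y = 1[{r,s} ~ v]` reads only the right edges. -/
lemma aInd_congr_right (h : CutVertex ends side L v Rt) {r s : V} (hr : r ∈ Rt ∨ r = v)
    (hs : s ∈ Rt ∨ s = v) {ω ω' : Config E} (hag : ∀ e, side e = false → ω e = ω' e) :
    aInd ends r s v ω = aInd ends r s v ω' := by
  unfold aInd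
  rw [conn_right_congr h hr (Or.inr rfl) hag, conn_right_congr h hs (Or.inr rfl) hag]

/-- **The product formula.** At a cut vertex,
`#Config · Σ_Sep σ_pq σ_rs = −2 · (Σ_ω a_Y σ_pq) · (Σ_ω b_Y σ_rs)`. -/
theorem card_mul_m9SignSum_eq (h : CutVertex ends side L v Rt) {p q r s : V}
    (hp : p ∈ L ∨ p = v) (hq : q ∈ L ∨ q = v) (hr : r ∈ Rt ∨ r = v) (hs : s ∈ Rt ∨ s = v) :
    (Fintype.card (Config E) : ℤ) * OneColourSwitch.m9SignSum ends p q r s =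
      -2 * (∑ ω : Config E, aInd ends p q v ω * OneColourSwitch.sigma ends ω p q) *
        (∑ ω : Config E, aInd ends r s v ω * OneColourSwitch.sigma ends ω r s) := by
  have hker : ∀ ω : Config E,
      (if OneColourSwitch.sep2 ends p q r s ω then
        OneColourSwitch.sigma ends ω p q * OneColourSwitch.sigma ends ω r s else 0) =
      OneColourSwitch.sigma ends ω p q * OneColourSwitch.sigma ends ω r s
      - (aInd ends p q v ω * OneColourSwitch.sigma ends ω p q) *
          (aInd ends r s v ω * OneColourSwitch.sigma ends ω r s)
      - (aInd ends p q v (OneColourSwitch.compl ω) * OneColourSwitch.sigma ends ω p q) *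
          (aInd ends r s v (OneColourSwitch.compl ω) * OneColourSwitch.sigma ends ω r s)
      + (aInd ends p q v ω * aInd ends p q v (OneColourSwitch.compl ω) *
          OneColourSwitch.sigma ends ω p q) *
        (aInd ends r s v ω * aInd ends r s v (OneColourSwitch.compl ω) *
          OneColourSwitch.sigma ends ω r s) := by
    intro ω
    rw [kernel_eq h hp hq hr hs ω]
    ring
  have i1 : (∑ ω : Config E, OneColourSwitch.sigma ends ω p q * OneColourSwitch.sigma ends ω r s) *
      (Fintype.card (Config E) : ℤ) =
      (∑ ω : Config E, OneColourSwitch.sigma ends ω p q) *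
        (∑ ω : Config E, OneColourSwitch.sigma ends ω r s) :=
    sum_mul_mul_card side _ _ (fun ω ω' hag => sigma_congr_left h hp hq hag)
      (fun ω ω' hag => sigma_congr_right h hr hs hag)
  have i2 : (∑ ω : Config E, (aInd ends p q v ω * OneColourSwitch.sigma ends ω p q) *
      (aInd ends r s v ω * OneColourSwitch.sigma ends ω r s)) * (Fintype.card (Config E) : ℤ) =
      (∑ ω : Config E, aInd ends p q v ω * OneColourSwitch.sigma ends ω p q) *
        (∑ ω : Config E, aInd ends r s v ω * OneColourSwitch.sigma ends ω r s) :=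
    sum_mul_mul_card side _ _
      (fun ω ω' hag => by rw [aInd_congr_left h hp hq hag, sigma_congr_left h hp hq hag])
      (fun ω ω' hag => by rw [aInd_congr_right h hr hs hag, sigma_congr_right h hr hs hag])
  have i3 : (∑ ω : Config E,
      (aInd ends p q v (OneColourSwitch.compl ω) * OneColourSwitch.sigma ends ω p q) *
      (aInd ends r s v (OneColourSwitch.compl ω) * OneColourSwitch.sigma ends ω r s)) *
      (Fintype.card (Config E) : ℤ) =
      (∑ ω : Config E, aInd ends p q v (OneColourSwitch.compl ω) *
        OneColourSwitch.sigma ends ω p q) *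
        (∑ ω : Config E, aInd ends r s v (OneColourSwitch.compl ω) *
          OneColourSwitch.sigma ends ω r s) :=
    sum_mul_mul_card side _ _
      (fun ω ω' hag => by
        rw [aInd_congr_left h hp hq (compl_agree hag), sigma_congr_left h hp hq hag])
      (fun ω ω' hag => by
        rw [aInd_congr_right h hr hs (compl_agree hag), sigma_congr_right h hr hs hag])
  have i4 : (∑ ω : Config E,
      (aInd ends p q v ω * aInd ends p q v (OneColourSwitch.compl ω) *
        OneColourSwitch.sigma ends ω p q) *
      (aInd ends r s v ω * aInd ends r s v (OneColourSwitch.compl ω) *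
        OneColourSwitch.sigma ends ω r s)) * (Fintype.card (Config E) : ℤ) =
      (∑ ω : Config E, aInd ends p q v ω * aInd ends p q v (OneColourSwitch.compl ω) *
        OneColourSwitch.sigma ends ω p q) *
        (∑ ω : Config E, aInd ends r s v ω * aInd ends r s v (OneColourSwitch.compl ω) *
          OneColourSwitch.sigma ends ω r s) :=
    sum_mul_mul_card side _ _
      (fun ω ω' hag => by
        rw [aInd_congr_left h hp hq hag, aInd_congr_left h hp hq (compl_agree hag),
          sigma_congr_left h hp hq hag])
      (fun ω ω' hag => by
        rw [aInd_congr_right h hr hs hag, aInd_congr_right h hr hs (compl_agree hag),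
          sigma_congr_right h hr hs hag])
  have f1 := sum_sigma_eq_zero (ends := ends) (E := E) p q
  have f2 := sum_aInd_compl_mul_sigma (ends := ends) (E := E) p q v
  have f3 := sum_aInd_compl_mul_sigma (ends := ends) (E := E) r s v
  have f4 := sum_aInd_mul_aInd_compl_mul_sigma (ends := ends) (E := E) p q v
  rw [f1, zero_mul] at i1
  rw [f2, f3] at i3
  rw [f4, zero_mul] at i4
  unfold OneColourSwitch.m9SignSum
  simp only [hker, Finset.sum_add_distrib, Finset.sum_sub_distrib]
  linear_combination i1 - i2 - i3 + i4

/-- **`m9` at a cut vertex**: if one vertex separates `{p,q}` from `{r,s}`, then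
`Σ_Sep σ_pq · σ_rs ≤ 0`. -/
theorem m9SignSum_nonpos_of_cutVertex (h : CutVertex ends side L v Rt) {p q r s : V}
    (hp : p ∈ L ∨ p = v) (hq : q ∈ L ∨ q = v) (hr : r ∈ Rt ∨ r = v) (hs : s ∈ Rt ∨ s = v) :
    OneColourSwitch.m9SignSum ends p q r s ≤ 0 := by
  have hN : (0 : ℤ) < Fintype.card (Config E) := by exact_mod_cast Fintype.card_pos
  have key := card_mul_m9SignSum_eq h hp hq hr hs
  have hα := aInd_mul_sigma_sum_nonneg ends p q v
  have hβ := aInd_mul_sigma_sum_nonneg ends r s v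
  have hprod : (Fintype.card (Config E) : ℤ) * OneColourSwitch.m9SignSum ends p q r s ≤ 0 := by
    rw [key]
    nlinarith [mul_nonneg hα hβ]
  rcases le_or_gt (OneColourSwitch.m9SignSum ends p q r s) 0 with hle | hlt
  · exact hle
  · exfalso
    have := mul_pos hN hlt
    linarith

end Main

end CutVertexM9

end Summit.Ventures.PercRepro2
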